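import Mathlib
import HarnessLib
import Summits.HubbardSuperconductivity.HubbardSuperconductivity.Theorems.KLProgrammePerturbedFermiCurveTwoFrameTower3
import Summits.HubbardSuperconductivity.HubbardSuperconductivity.Theorems.KLProgrammeC4aJacobianPolarJets
import Summits.HubbardSuperconductivity.HubbardSuperconductivity.Theorems.KLProgrammePerturbedFermiCurveQuotientDiff

/-!
# Route `KLProgramme` — TWO polar level curves: the polar JACOBIANS `J = u/D`, `D = De(u·dir)[dir]`, differ to order 2 by amounts
# LINEAR in the differences of the two level functions' derivatives at the two curve points (pointwise algebra + the quotient rule)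

Cell `gate-hubbard-kl`, seat hubbard-kl-k3c3-p3 (g7; row «implicit-function / monotonicity route for μ(n)»); helper for the engine-flow child
`KLRegimeEngineV17F2` (stmt-HubbardSuperconductivity-20437), stub (C) `stub_twoLeg_curvature`, plan (R47r) «window-specific certified Jacobian-jet
bundle» — c4a-1's Lean endpoint C4A-PLAN §15.3 (M-alt): `‖∂ⁱ J_K‖ ≤ jacCertG i + jacPert i`, `i ≤ 2`, where `jacCertG` is the CERTIFIED free-band table
(`FreeBandPolarJets`, …WindowJetsDefs / c4a-1's `JacJetEnclosures`) and `jacPert` the frame correction.  This module is the frame-INDEPENDENT half of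
`jacPert`: for two `C⁴` level functions `e, e′` on `Fin 2 → ℝ` with polar curves `u•dir`, `v•dir` in their level sets, at an angle `θ`, with
`A = De(p)`, `A₂ = D²e(p)`, `A₃ = D³e(p)` (`p = u θ•dir θ`), `Ã, Ã₂, Ã₃` the same for `e′` at `ṽ = v θ•dir θ`, radial slopes `D = A d₀`, `D̃ = Ã d₀`
(`d₀ = dir θ`) both `≥ ρ₀ > 0`, common sizes `‖A‖, ‖Ã‖ ≤ E₁`, `‖A₂‖, ‖Ã₂‖ ≤ E₂`, `‖A₃‖, ‖Ã₃‖ ≤ E₃`, `|u|, |v| ≤ U₀`, `|u′|, |v′| ≤ R₁`, `|u″|, |v″| ≤ R₂`,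
and differences `‖Ã − A‖ ≤ Δ₁`, `‖Ã₂ − A₂‖ ≤ Δ₂`, `‖Ã₃ − A₃‖ ≤ Δ₃`, `|v − u| ≤ W₀`, `|v′ − u′| ≤ W₁`, `|v″ − u″| ≤ W₂`:

* (§1 = `…PerturbedFermiCurveQuotientDiff`: the scalar quotient differences `x̃/D̃ − x/D`, `x̃ỹ/D̃² − xy/D²`, `x̃ỹ²/D̃³ − xy²/D³`);
* §2 the radial slopes' jets differ by `g₀ = Δ₁`, `g₁ = Δ₂K₁ + E₂(W₁+W₀) + Δ₁`, `g₂ = Δ₃K₁² + 2E₃K₁(W₁+W₀) + Δ₂K₂ + E₂(W₂+2W₁+W₀) + 2(Δ₂K₁ + E₂(W₁+W₀)) + Δ₁`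
  (`K₁ = R₁ + U₀`, `K₂ = R₂ + 2R₁ + U₀`; `D′`, `D″` in c4a-1's `hasDerivAt_radialSlope(_deriv)` form, sizes `S₁ = E₂K₁ + E₁`, `S₂ = E₃K₁² + E₂K₂ + 2E₂K₁ + E₁`);
* §3 **`abs_polarJac_sub_le`, `abs_deriv_polarJac_sub_le`, `abs_deriv_two_polarJac_sub_le`**: `|J̃ − J| ≤ W₀/ρ₀ + U₀Δ₁/ρ₀²`,
  `|J̃′ − J′| ≤ W₁/ρ₀ + R₁Δ₁/ρ₀² + (W₀S₁ + U₀g₁)/ρ₀² + 2U₀S₁Δ₁/ρ₀³`, and the order-2 analogue (four quotient-rule terms) — every term carries one difference factor.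

The frame instance (`e = ε₀`, `e′ = ε₀ + δ_K`, the W's of `…WindowJets`) is `…PerturbedFermiCurveWindowJetsJacobian`.  Everything is PROVED; no
definitions; nothing about the Hubbard model.  References: BGM 2006 §2.4 Lemma 2.1 (2.40) [cite: BenfattoGiulianiMastropietro2006].
-/

noncomputable section

namespace Summit.HubbardSuperconductivity.HubbardSuperconductivity.Theorems.PerturbedFermiCurve

set_option linter.dupNamespace false -- summit = problem name (single-conjunct summit), D-0017
set_option maxSynthPendingDepth 3 -- nested operator-norm instances (third Fréchet derivatives)

open Real Set
open Literature.MathematicalPhysics.QuantumLattice Literature.MathematicalPhysics.QuantumLattice.BandSectorCounting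
open Summit.HubbardSuperconductivity.HubbardSuperconductivity.Theorems.C4a

/-! ## §2 The radial slopes of two polar curves: `D`, `D′`, `D″` differ by `g₀ = Δ₁`, `g₁`, `g₂` -/

section Slopes

variable {A Ã : (Fin 2 → ℝ) →L[ℝ] ℝ} {A₂ Ã₂ : (Fin 2 → ℝ) →L[ℝ] (Fin 2 → ℝ) →L[ℝ] ℝ}
  {A₃ Ã₃ : (Fin 2 → ℝ) →L[ℝ] (Fin 2 → ℝ) →L[ℝ] (Fin 2 → ℝ) →L[ℝ] ℝ}
  {θ u0 u1 u2 v0 v1 v2 E₁ E₂ E₃ Δ₁ Δ₂ Δ₃ U₀ R₁ R₂ W₀ W₁ W₂ : ℝ}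
  (hE₁ : ‖A‖ ≤ E₁) (hE₂ : ‖A₂‖ ≤ E₂) (hE₃ : ‖A₃‖ ≤ E₃)
  (hΔ₁ : ‖Ã - A‖ ≤ Δ₁) (hΔ₂ : ‖Ã₂ - A₂‖ ≤ Δ₂) (hΔ₃ : ‖Ã₃ - A₃‖ ≤ Δ₃)
  (hU₀ : |u0| ≤ U₀) (hU₀' : |v0| ≤ U₀) (hR₁ : |u1| ≤ R₁) (hR₁' : |v1| ≤ R₁) (hR₂ : |u2| ≤ R₂) (hR₂' : |v2| ≤ R₂)
  (hW₀ : |v0 - u0| ≤ W₀) (hW₁ : |v1 - u1| ≤ W₁) (hW₂ : |v2 - u2| ≤ W₂)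

include hΔ₁ in
/-- **`g₀`**: `|Ã d₀ − A d₀| ≤ Δ₁`. -/
theorem abs_slope_sub_le : |Ã (dir θ) - A (dir θ)| ≤ Δ₁ := by
  have h := abs_apply_sub_le' hΔ₁ le_rfl (norm_dir_le_one θ) (x := dir θ) (by simp : ‖dir θ - dir θ‖ ≤ 0)
  simpa using h

omit hE₃ hΔ₃ hR₂ hR₂' hW₂ in
include hE₁ hE₂ hΔ₁ hΔ₂ hU₀ hU₀' hR₁ hR₁' hW₀ hW₁ in
/-- **`g₁`**: the `D′`-expressions (`A₂ k₁ d₀ + A d₁`, `k₁ = u₁•d₀ + u₀•d₁`) of the two curves differ by at most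
`Δ₂(R₁+U₀) + E₂(W₁+W₀) + Δ₁`. -/
theorem abs_slope_deriv_sub_le :
    |(Ã₂ (v1 • dir θ + v0 • dir (θ + π / 2)) (dir θ) + Ã (dir (θ + π / 2))) -
        (A₂ (u1 • dir θ + u0 • dir (θ + π / 2)) (dir θ) + A (dir (θ + π / 2)))| ≤
      Δ₂ * (R₁ + U₀) + E₂ * (W₁ + W₀) + Δ₁ := by
  have hk : ‖u1 • dir θ + u0 • dir (θ + π / 2)‖ ≤ R₁ + U₀ := (norm_frame_comb_le _ _ θ).trans (add_le_add hR₁ hU₀)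
  have hk' : ‖v1 • dir θ + v0 • dir (θ + π / 2)‖ ≤ R₁ + U₀ := (norm_frame_comb_le _ _ θ).trans (add_le_add hR₁' hU₀')
  have hdk : ‖(v1 • dir θ + v0 • dir (θ + π / 2)) - (u1 • dir θ + u0 • dir (θ + π / 2))‖ ≤ W₁ + W₀ := by
    have e1 : (v1 • dir θ + v0 • dir (θ + π / 2)) - (u1 • dir θ + u0 • dir (θ + π / 2)) =
        (v1 - u1) • dir θ + (v0 - u0) • dir (θ + π / 2) := by simp only [sub_smul]; abel
    rw [e1]; exact (norm_frame_comb_le _ _ θ).trans (add_le_add hW₁ hW₀)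
  have h1 := abs_apply₂_sub_le' hΔ₂ hE₂ hk hk' (norm_dir_le_one θ) hdk (by simp : ‖dir θ - dir θ‖ ≤ 0)
  have h2 := abs_apply_sub_le' hΔ₁ hE₁ (norm_dir_le_one (θ + π / 2)) (x := dir (θ + π / 2))
    (by simp : ‖dir (θ + π / 2) - dir (θ + π / 2)‖ ≤ 0)
  have e2 : (Ã₂ (v1 • dir θ + v0 • dir (θ + π / 2)) (dir θ) + Ã (dir (θ + π / 2))) -
      (A₂ (u1 • dir θ + u0 • dir (θ + π / 2)) (dir θ) + A (dir (θ + π / 2))) =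
      (Ã₂ (v1 • dir θ + v0 • dir (θ + π / 2)) (dir θ) - A₂ (u1 • dir θ + u0 • dir (θ + π / 2)) (dir θ)) +
        (Ã (dir (θ + π / 2)) - A (dir (θ + π / 2))) := by ring
  rw [e2]
  refine (abs_add_le _ _).trans ?_
  calc _ ≤ Δ₂ * (R₁ + U₀) * 1 + E₂ * ((W₁ + W₀) * 1 + (R₁ + U₀) * 0) + (Δ₁ * 1 + E₁ * 0) := add_le_add h1 h2
    _ = Δ₂ * (R₁ + U₀) + E₂ * (W₁ + W₀) + Δ₁ := by ring

include hE₁ hE₂ hE₃ hΔ₁ hΔ₂ hΔ₃ hU₀ hU₀' hR₁ hR₁' hR₂ hR₂' hW₀ hW₁ hW₂ in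
/-- **`g₂`**: the `D″`-expressions (`(A₃ k₁ k₁ + A₂ r) d₀ + A₂ k₁ d₁ + (A₂ k₁ d₁ + A(−d₀))`, `r = (u₂−u₀)•d₀ + 2u₁•d₁`) of the two curves
differ by at most `Δ₃K₁² + 2E₃K₁(W₁+W₀) + Δ₂K₂ + E₂(W₂+2W₁+W₀) + 2(Δ₂K₁ + E₂(W₁+W₀)) + Δ₁`, `K₁ = R₁+U₀`, `K₂ = R₂+U₀+2R₁`. -/
theorem abs_slope_deriv_two_sub_le :
    |((Ã₃ (v1 • dir θ + v0 • dir (θ + π / 2)) (v1 • dir θ + v0 • dir (θ + π / 2)) +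
          Ã₂ ((v2 - v0) • dir θ + (2 * v1) • dir (θ + π / 2))) (dir θ) +
        Ã₂ (v1 • dir θ + v0 • dir (θ + π / 2)) (dir (θ + π / 2)) +
        (Ã₂ (v1 • dir θ + v0 • dir (θ + π / 2)) (dir (θ + π / 2)) + Ã (-dir θ))) -
      ((A₃ (u1 • dir θ + u0 • dir (θ + π / 2)) (u1 • dir θ + u0 • dir (θ + π / 2)) +
          A₂ ((u2 - u0) • dir θ + (2 * u1) • dir (θ + π / 2))) (dir θ) +
        A₂ (u1 • dir θ + u0 • dir (θ + π / 2)) (dir (θ + π / 2)) +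
        (A₂ (u1 • dir θ + u0 • dir (θ + π / 2)) (dir (θ + π / 2)) + A (-dir θ)))| ≤
      Δ₃ * (R₁ + U₀) ^ 2 + 2 * E₃ * (R₁ + U₀) * (W₁ + W₀) + Δ₂ * (R₂ + U₀ + 2 * R₁) + E₂ * (W₂ + 2 * W₁ + W₀) +
        2 * (Δ₂ * (R₁ + U₀) + E₂ * (W₁ + W₀)) + Δ₁ := by
  set d₀ := dir θ with hd₀
  set d₁ := dir (θ + π / 2) with hd₁
  set k := u1 • d₀ + u0 • d₁ with hk0
  set k' := v1 • d₀ + v0 • d₁ with hk0'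
  set r := (u2 - u0) • d₀ + (2 * u1) • d₁ with hr0
  set r' := (v2 - v0) • d₀ + (2 * v1) • d₁ with hr0'
  have hfc : ∀ a b : ℝ, ‖a • d₀ + b • d₁‖ ≤ |a| + |b| := fun a b => by rw [hd₀, hd₁]; exact norm_frame_comb_le a b θ
  have hnd₀ : ‖d₀‖ ≤ 1 := hd₀ ▸ norm_dir_le_one _
  have hnd₁ : ‖d₁‖ ≤ 1 := hd₁ ▸ norm_dir_le_one _
  have hk : ‖k‖ ≤ R₁ + U₀ := (hfc _ _).trans (add_le_add hR₁ hU₀)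
  have hk' : ‖k'‖ ≤ R₁ + U₀ := (hfc _ _).trans (add_le_add hR₁' hU₀')
  have hdk : ‖k' - k‖ ≤ W₁ + W₀ := by
    have e1 : k' - k = (v1 - u1) • d₀ + (v0 - u0) • d₁ := by simp only [hk0, hk0', sub_smul]; abel
    rw [e1]; exact (hfc _ _).trans (add_le_add hW₁ hW₀)
  have hr : ‖r‖ ≤ R₂ + U₀ + 2 * R₁ := by
    refine (hfc _ _).trans (add_le_add ((abs_sub _ _).trans (add_le_add hR₂ hU₀)) ?_)
    rw [abs_mul, abs_two]; linarith
  have hr' : ‖r'‖ ≤ R₂ + U₀ + 2 * R₁ := by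
    refine (hfc _ _).trans (add_le_add ((abs_sub _ _).trans (add_le_add hR₂' hU₀')) ?_)
    rw [abs_mul, abs_two]; linarith
  have hdr : ‖r' - r‖ ≤ W₂ + 2 * W₁ + W₀ := by
    have e1 : r' - r = ((v2 - u2) - (v0 - u0)) • d₀ + (2 * (v1 - u1)) • d₁ := by
      simp only [hr0, hr0', sub_smul, mul_sub]; abel
    rw [e1]
    refine (hfc _ _).trans ?_
    have h2 : |2 * (v1 - u1)| ≤ 2 * W₁ := by rw [abs_mul, abs_two]; linarith
    linarith [(abs_sub (v2 - u2) (v0 - u0)).trans (add_le_add hW₂ hW₀)]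
  have hd00 : ‖d₀ - d₀‖ ≤ 0 := by simp
  have hd11 : ‖d₁ - d₁‖ ≤ 0 := by simp
  -- the five differences
  have Ta := abs_apply₃_sub_le' hΔ₃ hE₃ hk hk' hk hk' hnd₀ hdk hdk hd00
  have Tb := abs_apply₂_sub_le' hΔ₂ hE₂ hr hr' hnd₀ hdr hd00
  have Tc := abs_apply₂_sub_le' hΔ₂ hE₂ hk hk' hnd₁ hdk hd11
  have Te : |Ã (-d₀) - A (-d₀)| ≤ Δ₁ * 1 + E₁ * 0 :=
    abs_apply_sub_le' hΔ₁ hE₁ (by rw [norm_neg]; exact hnd₀) (by simp : ‖-d₀ - -d₀‖ ≤ 0)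
  have e2 : ((Ã₃ k' k' + Ã₂ r') d₀ + Ã₂ k' d₁ + (Ã₂ k' d₁ + Ã (-d₀))) - ((A₃ k k + A₂ r) d₀ + A₂ k d₁ + (A₂ k d₁ + A (-d₀))) =
      (Ã₃ k' k' d₀ - A₃ k k d₀) + (Ã₂ r' d₀ - A₂ r d₀) + (Ã₂ k' d₁ - A₂ k d₁) + ((Ã₂ k' d₁ - A₂ k d₁) + (Ã (-d₀) - A (-d₀))) := by
    simp only [add_apply]; ring
  rw [e2]
  have hsum : |(Ã₃ k' k' d₀ - A₃ k k d₀) + (Ã₂ r' d₀ - A₂ r d₀) + (Ã₂ k' d₁ - A₂ k d₁) + ((Ã₂ k' d₁ - A₂ k d₁) + (Ã (-d₀) - A (-d₀)))| ≤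
      |Ã₃ k' k' d₀ - A₃ k k d₀| + |Ã₂ r' d₀ - A₂ r d₀| + |Ã₂ k' d₁ - A₂ k d₁| + (|Ã₂ k' d₁ - A₂ k d₁| + |Ã (-d₀) - A (-d₀)|) := by
    refine (abs_add_le _ _).trans (add_le_add ?_ (abs_add_le _ _))
    refine (abs_add_le _ _).trans (add_le_add ?_ le_rfl)
    exact abs_add_le _ _
  refine hsum.trans ?_
  calc _ ≤ (Δ₃ * (R₁ + U₀) * (R₁ + U₀) * 1 + E₃ * ((W₁ + W₀) * (R₁ + U₀) * 1 + (R₁ + U₀) * (W₁ + W₀) * 1 + (R₁ + U₀) * (R₁ + U₀) * 0)) +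
        (Δ₂ * (R₂ + U₀ + 2 * R₁) * 1 + E₂ * ((W₂ + 2 * W₁ + W₀) * 1 + (R₂ + U₀ + 2 * R₁) * 0)) +
        (Δ₂ * (R₁ + U₀) * 1 + E₂ * ((W₁ + W₀) * 1 + (R₁ + U₀) * 0)) +
        ((Δ₂ * (R₁ + U₀) * 1 + E₂ * ((W₁ + W₀) * 1 + (R₁ + U₀) * 0)) + (Δ₁ * 1 + E₁ * 0)) :=
        add_le_add (add_le_add (add_le_add Ta Tb) Tc) (add_le_add Tc Te)
    _ = _ := by ring

end Slopes

/-! ## §3 The polar Jacobians `J = u/D` of two polar curves: orders 0, 1, 2 -/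

section TwoPolar

variable {e e' : (Fin 2 → ℝ) → ℝ} (he : ContDiff ℝ 4 e) (he' : ContDiff ℝ 4 e') {u v : ℝ → ℝ} (hu : ContDiff ℝ 4 u)
  (hv : ContDiff ℝ 4 v)

/-- **Order 0**: `|ṽ/D̃ − u/D| ≤ W₀/ρ₀ + U₀Δ₁/ρ₀²`. -/
theorem abs_polarJac_sub_le {θ ρ₀ Δ₁ U₀ W₀ : ℝ} (hρ0 : 0 < ρ₀) (hρ : ρ₀ ≤ fderiv ℝ e (u θ • dir θ) (dir θ))
    (hρ' : ρ₀ ≤ fderiv ℝ e' (v θ • dir θ) (dir θ)) (hΔ₁ : ‖fderiv ℝ e' (v θ • dir θ) - fderiv ℝ e (u θ • dir θ)‖ ≤ Δ₁)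
    (hU₀ : |u θ| ≤ U₀) (hW₀ : |v θ - u θ| ≤ W₀) :
    |v θ / fderiv ℝ e' (v θ • dir θ) (dir θ) - u θ / fderiv ℝ e (u θ • dir θ) (dir θ)| ≤ W₀ / ρ₀ + U₀ * Δ₁ / ρ₀ ^ 2 :=
  abs_div_sub_div_le' hρ0 hρ hρ' (abs_slope_sub_le hΔ₁) hW₀ hU₀

include he he' hu hv in
/-- **Order 1**: with `S₁ = E₂(R₁+U₀) + E₁` (size of `D′`) and `g₁ = Δ₂(R₁+U₀) + E₂(W₁+W₀) + Δ₁` (difference of the `D′`):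
`|J̃′(θ) − J′(θ)| ≤ W₁/ρ₀ + R₁Δ₁/ρ₀² + (W₀S₁ + U₀g₁)/ρ₀² + 2U₀S₁Δ₁/ρ₀³`. [cite: BenfattoGiulianiMastropietro2006, §2.4 Lemma 2.1 (2.40)] -/
theorem abs_deriv_polarJac_sub_le {θ ρ₀ E₁ E₂ Δ₁ Δ₂ U₀ R₁ W₀ W₁ : ℝ} (hρ0 : 0 < ρ₀)
    (hρ : ρ₀ ≤ fderiv ℝ e (u θ • dir θ) (dir θ)) (hρ' : ρ₀ ≤ fderiv ℝ e' (v θ • dir θ) (dir θ))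
    (hE₁ : ‖fderiv ℝ e (u θ • dir θ)‖ ≤ E₁) (hE₁' : ‖fderiv ℝ e' (v θ • dir θ)‖ ≤ E₁)
    (hE₂ : ‖fderiv ℝ (fderiv ℝ e) (u θ • dir θ)‖ ≤ E₂) (hE₂' : ‖fderiv ℝ (fderiv ℝ e') (v θ • dir θ)‖ ≤ E₂)
    (hΔ₁ : ‖fderiv ℝ e' (v θ • dir θ) - fderiv ℝ e (u θ • dir θ)‖ ≤ Δ₁)
    (hΔ₂ : ‖fderiv ℝ (fderiv ℝ e') (v θ • dir θ) - fderiv ℝ (fderiv ℝ e) (u θ • dir θ)‖ ≤ Δ₂)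
    (hU₀ : |u θ| ≤ U₀) (hU₀' : |v θ| ≤ U₀) (hR₁ : |deriv u θ| ≤ R₁) (hR₁' : |deriv v θ| ≤ R₁)
    (hW₀ : |v θ - u θ| ≤ W₀) (hW₁ : |deriv v θ - deriv u θ| ≤ W₁) :
    |deriv (fun t : ℝ => v t / fderiv ℝ e' (v t • dir t) (dir t)) θ - deriv (fun t : ℝ => u t / fderiv ℝ e (u t • dir t) (dir t)) θ| ≤
      W₁ / ρ₀ + R₁ * Δ₁ / ρ₀ ^ 2 +
        ((W₀ * (E₂ * (R₁ + U₀) + E₁) + U₀ * (Δ₂ * (R₁ + U₀) + E₂ * (W₁ + W₀) + Δ₁)) / ρ₀ ^ 2 +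
          2 * (U₀ * (E₂ * (R₁ + U₀) + E₁)) * Δ₁ / ρ₀ ^ 3) := by
  have hDne : fderiv ℝ e (u θ • dir θ) (dir θ) ≠ 0 := (hρ0.trans_le hρ).ne'
  have hDne' : fderiv ℝ e' (v θ • dir θ) (dir θ) ≠ 0 := (hρ0.trans_le hρ').ne'
  rw [(hasDerivAt_polarJac he hu hDne).deriv, (hasDerivAt_polarJac he' hv hDne').deriv]
  have hS₁ := abs_radialSlope_deriv_le hE₁ hE₂ hU₀ hR₁
  have hS₁' := abs_radialSlope_deriv_le hE₁' hE₂' hU₀' hR₁'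
  have hg₁ := abs_slope_deriv_sub_le hE₁ hE₂ hΔ₁ hΔ₂ hU₀ hU₀' hR₁ hR₁' hW₀ hW₁ (θ := θ)
  have hg₀ := abs_slope_sub_le hΔ₁ (θ := θ)
  set D : ℝ := fderiv ℝ e (u θ • dir θ) (dir θ) with hDdef
  set D₁ : ℝ := fderiv ℝ (fderiv ℝ e) (u θ • dir θ) (deriv u θ • dir θ + u θ • dir (θ + π / 2)) (dir θ) +
    fderiv ℝ e (u θ • dir θ) (dir (θ + π / 2)) with hD₁def
  set Dt : ℝ := fderiv ℝ e' (v θ • dir θ) (dir θ) with hDtdef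
  set Dt₁ : ℝ := fderiv ℝ (fderiv ℝ e') (v θ • dir θ) (deriv v θ • dir θ + v θ • dir (θ + π / 2)) (dir θ) +
    fderiv ℝ e' (v θ • dir θ) (dir (θ + π / 2)) with hDt₁def
  have hDpos : 0 < D := hρ0.trans_le hρ
  have hDtpos : 0 < Dt := hρ0.trans_le hρ'
  have hsplit : (deriv u θ * D - u θ * D₁) / D ^ 2 = deriv u θ / D - u θ * D₁ / D ^ 2 := by field_simp
  have hsplit' : (deriv v θ * Dt - v θ * Dt₁) / Dt ^ 2 = deriv v θ / Dt - v θ * Dt₁ / Dt ^ 2 := by field_simp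
  rw [hsplit, hsplit']
  have e1 : deriv v θ / Dt - v θ * Dt₁ / Dt ^ 2 - (deriv u θ / D - u θ * D₁ / D ^ 2) =
      (deriv v θ / Dt - deriv u θ / D) - (v θ * Dt₁ / Dt ^ 2 - u θ * D₁ / D ^ 2) := by ring
  rw [e1]
  refine (abs_sub _ _).trans (add_le_add ?_ ?_)
  · exact abs_div_sub_div_le' hρ0 hρ hρ' hg₀ hW₁ hR₁
  · exact abs_mul_div_sq_sub_le hρ0 hρ hρ' hg₀ hW₀ hU₀ hS₁ hS₁' hg₁

include he he' hu hv in
/-- **Order 2**: with `S₁ = E₂K₁ + E₁`, `S₂ = E₃K₁² + E₂(R₂+2R₁+U₀) + 2E₂K₁ + E₁` (sizes of `D′`, `D″`), `g₁` as above and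
`g₂ = Δ₃K₁² + 2E₃K₁(W₁+W₀) + Δ₂(R₂+U₀+2R₁) + E₂(W₂+2W₁+W₀) + 2(Δ₂K₁ + E₂(W₁+W₀)) + Δ₁` (`K₁ = R₁+U₀`), transversality at EVERY angle:
`|J̃″(θ) − J″(θ)| ≤ [W₂/ρ₀ + R₂Δ₁/ρ₀²] + [(W₀S₂ + U₀g₂)/ρ₀² + 2U₀S₂Δ₁/ρ₀³] + 2[(W₁S₁ + R₁g₁)/ρ₀² + 2R₁S₁Δ₁/ρ₀³] + 2[(W₀S₁² + 2U₀S₁g₁)/ρ₀³ + 3U₀S₁²Δ₁/ρ₀⁴]`.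
[cite: BenfattoGiulianiMastropietro2006, §2.4 Lemma 2.1 (2.40)] -/
theorem abs_deriv_two_polarJac_sub_le {θ ρ₀ E₁ E₂ E₃ Δ₁ Δ₂ Δ₃ U₀ R₁ R₂ W₀ W₁ W₂ : ℝ} (hρ0 : 0 < ρ₀)
    (hρ : ∀ ϑ, ρ₀ ≤ fderiv ℝ e (u ϑ • dir ϑ) (dir ϑ)) (hρ' : ∀ ϑ, ρ₀ ≤ fderiv ℝ e' (v ϑ • dir ϑ) (dir ϑ))
    (hE₁ : ‖fderiv ℝ e (u θ • dir θ)‖ ≤ E₁) (hE₁' : ‖fderiv ℝ e' (v θ • dir θ)‖ ≤ E₁)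
    (hE₂ : ‖fderiv ℝ (fderiv ℝ e) (u θ • dir θ)‖ ≤ E₂) (hE₂' : ‖fderiv ℝ (fderiv ℝ e') (v θ • dir θ)‖ ≤ E₂)
    (hE₃ : ‖fderiv ℝ (fderiv ℝ (fderiv ℝ e)) (u θ • dir θ)‖ ≤ E₃) (hE₃' : ‖fderiv ℝ (fderiv ℝ (fderiv ℝ e')) (v θ • dir θ)‖ ≤ E₃)
    (hΔ₁ : ‖fderiv ℝ e' (v θ • dir θ) - fderiv ℝ e (u θ • dir θ)‖ ≤ Δ₁)
    (hΔ₂ : ‖fderiv ℝ (fderiv ℝ e') (v θ • dir θ) - fderiv ℝ (fderiv ℝ e) (u θ • dir θ)‖ ≤ Δ₂)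
    (hΔ₃ : ‖fderiv ℝ (fderiv ℝ (fderiv ℝ e')) (v θ • dir θ) - fderiv ℝ (fderiv ℝ (fderiv ℝ e)) (u θ • dir θ)‖ ≤ Δ₃)
    (hU₀ : |u θ| ≤ U₀) (hU₀' : |v θ| ≤ U₀) (hR₁ : |deriv u θ| ≤ R₁) (hR₁' : |deriv v θ| ≤ R₁)
    (hR₂ : |deriv (deriv u) θ| ≤ R₂) (hR₂' : |deriv (deriv v) θ| ≤ R₂)
    (hW₀ : |v θ - u θ| ≤ W₀) (hW₁ : |deriv v θ - deriv u θ| ≤ W₁) (hW₂ : |deriv (deriv v) θ - deriv (deriv u) θ| ≤ W₂) :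
    |deriv (deriv (fun t : ℝ => v t / fderiv ℝ e' (v t • dir t) (dir t))) θ -
        deriv (deriv (fun t : ℝ => u t / fderiv ℝ e (u t • dir t) (dir t))) θ| ≤
      (W₂ / ρ₀ + R₂ * Δ₁ / ρ₀ ^ 2) +
        ((W₀ * (E₃ * (R₁ + U₀) ^ 2 + E₂ * (R₂ + 2 * R₁ + U₀) + 2 * (E₂ * (R₁ + U₀)) + E₁) +
              U₀ * (Δ₃ * (R₁ + U₀) ^ 2 + 2 * E₃ * (R₁ + U₀) * (W₁ + W₀) + Δ₂ * (R₂ + U₀ + 2 * R₁) + E₂ * (W₂ + 2 * W₁ + W₀) +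
                2 * (Δ₂ * (R₁ + U₀) + E₂ * (W₁ + W₀)) + Δ₁)) / ρ₀ ^ 2 +
          2 * (U₀ * (E₃ * (R₁ + U₀) ^ 2 + E₂ * (R₂ + 2 * R₁ + U₀) + 2 * (E₂ * (R₁ + U₀)) + E₁)) * Δ₁ / ρ₀ ^ 3) +
        2 * ((W₁ * (E₂ * (R₁ + U₀) + E₁) + R₁ * (Δ₂ * (R₁ + U₀) + E₂ * (W₁ + W₀) + Δ₁)) / ρ₀ ^ 2 +
          2 * (R₁ * (E₂ * (R₁ + U₀) + E₁)) * Δ₁ / ρ₀ ^ 3) +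
        2 * ((W₀ * (E₂ * (R₁ + U₀) + E₁) ^ 2 + 2 * (U₀ * (E₂ * (R₁ + U₀) + E₁)) * (Δ₂ * (R₁ + U₀) + E₂ * (W₁ + W₀) + Δ₁)) / ρ₀ ^ 3 +
          3 * (U₀ * (E₂ * (R₁ + U₀) + E₁) ^ 2) * Δ₁ / ρ₀ ^ 4) := by
  have hDne : ∀ ϑ, fderiv ℝ e (u ϑ • dir ϑ) (dir ϑ) ≠ 0 := fun ϑ => (hρ0.trans_le (hρ ϑ)).ne'
  have hDne' : ∀ ϑ, fderiv ℝ e' (v ϑ • dir ϑ) (dir ϑ) ≠ 0 := fun ϑ => (hρ0.trans_le (hρ' ϑ)).ne'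
  rw [(hasDerivAt_deriv_polarJac he hu hDne θ).deriv, (hasDerivAt_deriv_polarJac he' hv hDne' θ).deriv]
  have hρθ := hρ θ
  have hρθ' := hρ' θ
  have hS₁ := abs_radialSlope_deriv_le hE₁ hE₂ hU₀ hR₁
  have hS₁' := abs_radialSlope_deriv_le hE₁' hE₂' hU₀' hR₁'
  have hS₂ := abs_radialSlope_deriv_two_le hE₁ hE₂ hE₃ hU₀ hR₁ hR₂
  have hS₂' := abs_radialSlope_deriv_two_le hE₁' hE₂' hE₃' hU₀' hR₁' hR₂'
  have hg₀ := abs_slope_sub_le hΔ₁ (θ := θ)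
  have hg₁ := abs_slope_deriv_sub_le hE₁ hE₂ hΔ₁ hΔ₂ hU₀ hU₀' hR₁ hR₁' hW₀ hW₁ (θ := θ)
  have hg₂ := abs_slope_deriv_two_sub_le hE₁ hE₂ hE₃ hΔ₁ hΔ₂ hΔ₃ hU₀ hU₀' hR₁ hR₁' hR₂ hR₂' hW₀ hW₁ hW₂ (θ := θ)
  set D : ℝ := fderiv ℝ e (u θ • dir θ) (dir θ) with hDdef
  set D₁ : ℝ := fderiv ℝ (fderiv ℝ e) (u θ • dir θ) (deriv u θ • dir θ + u θ • dir (θ + π / 2)) (dir θ) +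
    fderiv ℝ e (u θ • dir θ) (dir (θ + π / 2)) with hD₁def
  set D₂ : ℝ := (fderiv ℝ (fderiv ℝ (fderiv ℝ e)) (u θ • dir θ) (deriv u θ • dir θ + u θ • dir (θ + π / 2))
        (deriv u θ • dir θ + u θ • dir (θ + π / 2)) +
      fderiv ℝ (fderiv ℝ e) (u θ • dir θ) ((deriv (deriv u) θ - u θ) • dir θ + (2 * deriv u θ) • dir (θ + π / 2))) (dir θ) +
    fderiv ℝ (fderiv ℝ e) (u θ • dir θ) (deriv u θ • dir θ + u θ • dir (θ + π / 2)) (dir (θ + π / 2)) +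
    (fderiv ℝ (fderiv ℝ e) (u θ • dir θ) (deriv u θ • dir θ + u θ • dir (θ + π / 2)) (dir (θ + π / 2)) +
      fderiv ℝ e (u θ • dir θ) (-dir θ)) with hD₂def
  set Dt : ℝ := fderiv ℝ e' (v θ • dir θ) (dir θ) with hDtdef
  set Dt₁ : ℝ := fderiv ℝ (fderiv ℝ e') (v θ • dir θ) (deriv v θ • dir θ + v θ • dir (θ + π / 2)) (dir θ) +
    fderiv ℝ e' (v θ • dir θ) (dir (θ + π / 2)) with hDt₁def
  set Dt₂ : ℝ := (fderiv ℝ (fderiv ℝ (fderiv ℝ e')) (v θ • dir θ) (deriv v θ • dir θ + v θ • dir (θ + π / 2))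
        (deriv v θ • dir θ + v θ • dir (θ + π / 2)) +
      fderiv ℝ (fderiv ℝ e') (v θ • dir θ) ((deriv (deriv v) θ - v θ) • dir θ + (2 * deriv v θ) • dir (θ + π / 2))) (dir θ) +
    fderiv ℝ (fderiv ℝ e') (v θ • dir θ) (deriv v θ • dir θ + v θ • dir (θ + π / 2)) (dir (θ + π / 2)) +
    (fderiv ℝ (fderiv ℝ e') (v θ • dir θ) (deriv v θ • dir θ + v θ • dir (θ + π / 2)) (dir (θ + π / 2)) +
      fderiv ℝ e' (v θ • dir θ) (-dir θ)) with hDt₂def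
  set u0 := u θ
  set u1 := deriv u θ
  set u2 := deriv (deriv u) θ
  set v0 := v θ
  set v1 := deriv v θ
  set v2 := deriv (deriv v) θ
  have hDpos : 0 < D := hρ0.trans_le hρθ
  have hDtpos : 0 < Dt := hρ0.trans_le hρθ'
  have hsplit : (((u2 * D + u1 * D₁) - (u1 * D₁ + u0 * D₂)) * D ^ 2 - (u1 * D - u0 * D₁) * (2 * D * D₁)) / (D ^ 2) ^ 2 =
      u2 / D - u0 * D₂ / D ^ 2 - 2 * (u1 * D₁ / D ^ 2) + 2 * (u0 * D₁ ^ 2 / D ^ 3) := by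
    field_simp
    ring
  have hsplit' : (((v2 * Dt + v1 * Dt₁) - (v1 * Dt₁ + v0 * Dt₂)) * Dt ^ 2 - (v1 * Dt - v0 * Dt₁) * (2 * Dt * Dt₁)) / (Dt ^ 2) ^ 2 =
      v2 / Dt - v0 * Dt₂ / Dt ^ 2 - 2 * (v1 * Dt₁ / Dt ^ 2) + 2 * (v0 * Dt₁ ^ 2 / Dt ^ 3) := by
    field_simp
    ring
  rw [hsplit, hsplit']
  have e1 : v2 / Dt - v0 * Dt₂ / Dt ^ 2 - 2 * (v1 * Dt₁ / Dt ^ 2) + 2 * (v0 * Dt₁ ^ 2 / Dt ^ 3) -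
        (u2 / D - u0 * D₂ / D ^ 2 - 2 * (u1 * D₁ / D ^ 2) + 2 * (u0 * D₁ ^ 2 / D ^ 3)) =
      (v2 / Dt - u2 / D) - (v0 * Dt₂ / Dt ^ 2 - u0 * D₂ / D ^ 2) - 2 * (v1 * Dt₁ / Dt ^ 2 - u1 * D₁ / D ^ 2) +
        2 * (v0 * Dt₁ ^ 2 / Dt ^ 3 - u0 * D₁ ^ 2 / D ^ 3) := by ring
  rw [e1]
  have T1 := abs_div_sub_div_le' hρ0 hρθ hρθ' hg₀ hW₂ hR₂
  have T2 := abs_mul_div_sq_sub_le hρ0 hρθ hρθ' hg₀ hW₀ hU₀ hS₂ hS₂' hg₂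
  have T3 := abs_mul_div_sq_sub_le hρ0 hρθ hρθ' hg₀ hW₁ hR₁ hS₁ hS₁' hg₁
  have T4 := abs_mul_sq_div_cube_sub_le hρ0 hρθ hρθ' hg₀ hW₀ hU₀ hS₁ hS₁' hg₁
  have habs : |(v2 / Dt - u2 / D) - (v0 * Dt₂ / Dt ^ 2 - u0 * D₂ / D ^ 2) - 2 * (v1 * Dt₁ / Dt ^ 2 - u1 * D₁ / D ^ 2) +
        2 * (v0 * Dt₁ ^ 2 / Dt ^ 3 - u0 * D₁ ^ 2 / D ^ 3)| ≤
      |v2 / Dt - u2 / D| + |v0 * Dt₂ / Dt ^ 2 - u0 * D₂ / D ^ 2| + 2 * |v1 * Dt₁ / Dt ^ 2 - u1 * D₁ / D ^ 2| +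
        2 * |v0 * Dt₁ ^ 2 / Dt ^ 3 - u0 * D₁ ^ 2 / D ^ 3| := by
    have h2 : ∀ x : ℝ, |2 * x| = 2 * |x| := fun x => by rw [abs_mul, abs_two]
    refine (abs_add_le _ _).trans (add_le_add ?_ (by rw [h2]))
    refine (abs_sub _ _).trans (add_le_add ?_ (by rw [h2]))
    exact abs_sub _ _
  refine habs.trans (add_le_add (add_le_add (add_le_add T1 T2) ?_) ?_)
  · exact mul_le_mul_of_nonneg_left T3 (by norm_num)
  · exact mul_le_mul_of_nonneg_left T4 (by norm_num)

end TwoPolar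

end Summit.HubbardSuperconductivity.HubbardSuperconductivity.Theorems.PerturbedFermiCurve

end
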